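import Summits.ValiantsHypothesis.ValiantsHypothesis.Theorems.KPlusLogSqLawStaticPathParticles

/-!
# Route «KPlusLogSqLaw» — parametric max-weight independent set on a path: THE EVENT DICTIONARY (hop / pair creation / pair annihilation)

HONEST FRAMING.  Helper toward the crux `WeakLifting` (item `stmt-ValiantsHypothesis-19561`, route `KPlusLogSqLaw`, cell `pub-symmetroid`,
seat val-sym-lift-p4 g22, 2026-08-29) on the line of its witness-plan stub `stub_tridiagonalSectorB` (tropical twin of the STATIC tridiagonal
sector = parametric maximum-weight independent set on a path).  Sequel of `…StaticPathExchange` (`ne_iff_flip_and_indep_symmDiff`: the optimum changes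
across the crossing `(S_α, S_κ)` iff the pair flips and the toggle of the items `α+1, …, κ` is feasible) and `…StaticPathParticles` (`indep_symmDiff_Ioc_iff`:
feasibility = no dimer sticks out of the stretch and no uncovered position strictly inside).  Here the feasibility is spelled out in the language of the
UNCOVERED POSITIONS of `M` («particles», memo `HOME/val-sym-lift-p4/PARTICLES.md` §2), giving the event dictionary of the static path sector in the kernel:
* `indep_symmDiff_iff_of_same_parity` — for `α ≡ κ (mod 2)`: the toggle is feasible iff every position strictly between is covered and ONE END IS UNCOVERED
  (then exactly one: a HOP of that particle to the other end);
* `indep_symmDiff_iff_of_mixed_parity` — for `α ≢ κ (mod 2)`: feasible iff every position strictly between is covered and EITHER both ends are uncovered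
  (ANNIHILATION of two adjacent particles) OR both ends are covered from inside the stretch, `i+α+1 ∈ M` and `i+κ ∈ M` (CREATION of two particles);
* **`ne_iff_hop`**, **`ne_iff_pair`** — combined with the exchange form: across an adjacent transposition of two prefix-sum lines of the same parity the unique
  optimum changes iff the pair flips, one of the two positions is uncovered and no position strictly between is; of opposite parity iff the pair flips, no
  position strictly between is uncovered, and the two ends are both uncovered or both covered inward.
Statements about a path DP; nothing here asserts anything about `WeakLifting`, `TropicalB`, `KPlusLogSqLaw`, the stub in its window, `MatrixDescartes`
(stmt-ValiantsHypothesis-18050) or `VP ≠ VNP`; the ORDER QUESTION stays open.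
-/

set_option linter.dupNamespace false
set_option autoImplicit false

namespace Summit.ValiantsHypothesis.ValiantsHypothesis.Theorems.KPlusLogSqLaw

open Finset Classical
open scoped symmDiff

namespace StaticPathFold

noncomputable section

/-! ## 1. Feasibility of the toggle in the language of uncovered positions -/

section Feasible

/-- **same parity: feasible iff the interior is covered and one end is uncovered.**  For an independent `M`, `α < κ`, `α ≡ κ (mod 2)`:
`M ∆ {i+α+1, …, i+κ}` is independent iff no position strictly between `α` and `κ` is uncovered and position `α` or position `κ` is uncovered (the two
cannot both be: the interior has odd length). [folklore] -/
theorem indep_symmDiff_iff_of_same_parity {M : Finset ℕ} (hM : Indep M) {i α κ : ℕ} (hακ : α < κ) (hpar : Even (α + κ)) :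
    Indep (M ∆ Ioc (i + α) (i + κ)) ↔
      ((∀ x, α < x → x < κ → ¬ (i + x ∉ M ∧ i + x + 1 ∉ M)) ∧
        ((i + α ∉ M ∧ i + α + 1 ∉ M) ∨ (i + κ ∉ M ∧ i + κ + 1 ∉ M))) := by
  rw [indep_symmDiff_Ioc_iff hM (by omega : i + α < i + κ)]
  have hev : Even (κ - α) := by
    rw [Nat.even_iff] at hpar ⊢; omega
  constructor
  · rintro ⟨ha, hb, hin⟩
    have hcov : ∀ x, α < x → x < κ → ¬ (i + x ∉ M ∧ i + x + 1 ∉ M) := fun x h1 h2 hx => by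
      rcases hin (i + x) (by omega) (by omega) with h | h
      · exact hx.1 h
      · exact hx.2 h
    refine ⟨hcov, ?_⟩
    by_cases hα1 : i + α + 1 ∈ M
    · -- `α` covered inward: membership alternates along the (feasible) stretch, so by parity `i + κ ∉ M`: `κ` is uncovered
      right
      refine ⟨fun hκ => ?_, hb⟩
      have hT : Indep (M ∆ Ioc (i + α) (i + κ)) := (indep_symmDiff_Ioc_iff hM (by omega)).mpr ⟨ha, hb, hin⟩
      have halt : ∀ d t, t = i + α + 1 + d → t ≤ i + κ → (t ∈ M ↔ Even d) := by
        intro d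
        induction d with
        | zero => intro t ht _; subst ht; exact ⟨fun _ => by norm_num, fun _ => hα1⟩
        | succ d ih =>
          intro t ht htk
          have ih' := ih (t - 1) (by omega) (by omega)
          have hs := mem_succ_iff_not_mem_of_indep hM hT (show i + α < t - 1 by omega) (show t - 1 + 1 ≤ i + κ by omega)
          rw [show t - 1 + 1 = t by omega] at hs
          rw [hs, Nat.even_add_one]
          exact not_congr ih'
      have := (halt (κ - α - 1) (i + κ) (by omega) le_rfl).mp hκ
      rw [Nat.even_iff] at this hev; omega
    · left; exact ⟨ha, hα1⟩
  · rintro ⟨hcov, hend⟩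
    have hin : ∀ t, i + α < t → t < i + κ → (t ∈ M ∨ t + 1 ∈ M) := fun t h1 h2 => by
      have hc := hcov (t - i) (by omega) (by omega)
      rw [show i + (t - i) = t by omega] at hc; tauto
    rcases hend with hα | hκ
    · -- left end uncovered: the pattern gives `i + κ ∈ M`, hence `i + κ + 1 ∉ M`
      have hpat := mem_iff_even_of_uncovered_left hM hα hcov
      have hk : i + κ ∈ M := (hpat (κ - α - 1) (i + κ) (by omega) le_rfl).mpr (by rw [Nat.odd_iff]; rw [Nat.even_iff] at hev; omega)
      exact ⟨hα.1, hM _ hk, hin⟩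
    · have hpat := mem_iff_odd_of_uncovered_right hM hκ hcov
      have h1 : i + α + 1 ∈ M := (hpat (κ - α - 1) (i + α + 1) (by omega) (by omega)).mpr (by rw [Nat.odd_iff]; rw [Nat.even_iff] at hev; omega)
      exact ⟨fun h0 => hM _ h0 h1, hκ.2, hin⟩

/-- **opposite parity: feasible iff the interior is covered and the ends are both uncovered or both covered inward.**  For an independent `M`, `α < κ`,
`α ≢ κ (mod 2)`: `M ∆ {i+α+1, …, i+κ}` is independent iff no position strictly between is uncovered and EITHER both positions `α`, `κ` are uncovered
(annihilation) OR `i+α+1 ∈ M` and `i+κ ∈ M` (both ends covered by dimers inside the stretch: creation). [folklore] -/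
theorem indep_symmDiff_iff_of_mixed_parity {M : Finset ℕ} (hM : Indep M) {i α κ : ℕ} (hακ : α < κ) (hpar : Odd (α + κ)) :
    Indep (M ∆ Ioc (i + α) (i + κ)) ↔
      ((∀ x, α < x → x < κ → ¬ (i + x ∉ M ∧ i + x + 1 ∉ M)) ∧
        (((i + α ∉ M ∧ i + α + 1 ∉ M) ∧ (i + κ ∉ M ∧ i + κ + 1 ∉ M)) ∨ (i + α + 1 ∈ M ∧ i + κ ∈ M))) := by
  rw [indep_symmDiff_Ioc_iff hM (by omega : i + α < i + κ)]
  have hodd : Odd (κ - α) := by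
    rw [Nat.odd_iff] at hpar ⊢; omega
  constructor
  · rintro ⟨ha, hb, hin⟩
    have hcov : ∀ x, α < x → x < κ → ¬ (i + x ∉ M ∧ i + x + 1 ∉ M) := fun x h1 h2 hx => by
      rcases hin (i + x) (by omega) (by omega) with h | h
      · exact hx.1 h
      · exact hx.2 h
    refine ⟨hcov, ?_⟩
    have hT : Indep (M ∆ Ioc (i + α) (i + κ)) := (indep_symmDiff_Ioc_iff hM (by omega)).mpr ⟨ha, hb, hin⟩
    have halt : ∀ d t, t = i + α + 1 + d → t ≤ i + κ → (t ∈ M ↔ (i + α + 1 ∈ M ↔ Even d)) := by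
      intro d
      induction d with
      | zero => intro t ht _; subst ht; simp
      | succ d ih =>
        intro t ht htk
        have ih' := ih (t - 1) (by omega) (by omega)
        have hs := mem_succ_iff_not_mem_of_indep hM hT (show i + α < t - 1 by omega) (show t - 1 + 1 ≤ i + κ by omega)
        rw [show t - 1 + 1 = t by omega] at hs
        rw [hs, ih', Nat.even_add_one]; tauto
    have hκm : (i + κ ∈ M ↔ (i + α + 1 ∈ M ↔ Even (κ - α - 1))) := halt (κ - α - 1) (i + κ) (by omega) le_rfl
    have hev : Even (κ - α - 1) := by rw [Nat.even_iff]; rw [Nat.odd_iff] at hodd; omega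
    by_cases hα1 : i + α + 1 ∈ M
    · right; exact ⟨hα1, hκm.mpr (iff_of_true hα1 hev)⟩
    · left
      have hκ0 : i + κ ∉ M := fun h => hα1 ((hκm.mp h).mpr hev)
      exact ⟨⟨ha, hα1⟩, ⟨hκ0, hb⟩⟩
  · rintro ⟨hcov, hend⟩
    have hin : ∀ t, i + α < t → t < i + κ → (t ∈ M ∨ t + 1 ∈ M) := fun t h1 h2 => by
      have hc := hcov (t - i) (by omega) (by omega)
      rw [show i + (t - i) = t by omega] at hc; tauto
    rcases hend with ⟨hα, hκ⟩ | ⟨hα1, hκ⟩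
    · exact ⟨hα.1, hκ.2, hin⟩
    · exact ⟨fun h0 => hM _ h0 hα1, hM _ hκ, hin⟩

end Feasible

/-! ## 2. The dictionary across an adjacent transposition -/

section Dictionary

variable (w₁ w₀ : ℕ → ℝ)

/-- **HOPS.**  Across an adjacent transposition `(α, κ)`, `α < κ ≤ n`, `α ≡ κ (mod 2)`, of the prefix-sum lines (hypotheses of `ne_iff_event`), the unique
optimum changes iff the pair flips, no position strictly between `α` and `κ` is uncovered by `M`, and position `α` or position `κ` is uncovered — a particle
HOPS from the uncovered end to the other end. [folklore] -/
theorem ne_iff_hop {i n α κ : ℕ} {θ θ' : ℝ} {M M' : Finset ℕ} (hακ : α < κ) (hκn : κ ≤ n) (hpar : Even (α + κ))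
    (hM : M ∈ indepSets i n) (hM' : M' ∈ indepSets i n)
    (huniq : ∀ T ∈ indepSets i n, T ≠ M → ∑ t ∈ T, W w₁ w₀ t θ < ∑ t ∈ M, W w₁ w₀ t θ)
    (huniq' : ∀ T ∈ indepSets i n, T ≠ M' → ∑ t ∈ T, W w₁ w₀ t θ' < ∑ t ∈ M', W w₁ w₀ t θ')
    (hord : ∀ p q, p ≤ n → q ≤ n → ¬(p = α ∧ q = κ) → ¬(p = κ ∧ q = α) →
      (L (altA (shift i w₁)) (altB (shift i w₀)) p θ < L (altA (shift i w₁)) (altB (shift i w₀)) q θ ↔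
        L (altA (shift i w₁)) (altB (shift i w₀)) p θ' < L (altA (shift i w₁)) (altB (shift i w₀)) q θ'))
    (hdis : ∀ p q, p ≤ n → q ≤ n → p ≠ q → L (altA (shift i w₁)) (altB (shift i w₀)) p θ ≠ L (altA (shift i w₁)) (altB (shift i w₀)) q θ)
    (hdis' : ∀ p q, p ≤ n → q ≤ n → p ≠ q → L (altA (shift i w₁)) (altB (shift i w₀)) p θ' ≠ L (altA (shift i w₁)) (altB (shift i w₀)) q θ')
    (hadj : ∀ x, x ≤ n → x ≠ α → x ≠ κ →
      (L (altA (shift i w₁)) (altB (shift i w₀)) x θ < L (altA (shift i w₁)) (altB (shift i w₀)) α θ ↔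
        L (altA (shift i w₁)) (altB (shift i w₀)) x θ < L (altA (shift i w₁)) (altB (shift i w₀)) κ θ)) :
    M ≠ M' ↔
      ((L (altA (shift i w₁)) (altB (shift i w₀)) α θ < L (altA (shift i w₁)) (altB (shift i w₀)) κ θ ↔
          ¬ L (altA (shift i w₁)) (altB (shift i w₀)) α θ' < L (altA (shift i w₁)) (altB (shift i w₀)) κ θ') ∧
        (∀ x, α < x → x < κ → ¬ (i + x ∉ M ∧ i + x + 1 ∉ M)) ∧
        ((i + α ∉ M ∧ i + α + 1 ∉ M) ∨ (i + κ ∉ M ∧ i + κ + 1 ∉ M))) := by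
  rw [ne_iff_flip_and_indep_symmDiff w₁ w₀ hακ hκn hM hM' huniq huniq' hord hdis hdis' hadj, mem_indepSets,
    indep_symmDiff_iff_of_same_parity (mem_indepSets.mp hM).2 hακ hpar]
  have hsub : M ∆ Ioc (i + α) (i + κ) ⊆ Ioc i (i + n) := by
    intro t ht
    rw [Finset.mem_symmDiff] at ht
    rcases ht with ⟨htM, _⟩ | ⟨htI, _⟩
    · exact (mem_indepSets.mp hM).1 htM
    · have := mem_Ioc.mp htI; exact mem_Ioc.mpr ⟨by omega, by omega⟩
  tauto

/-- **PAIR CREATIONS AND ANNIHILATIONS.**  Across an adjacent transposition `(α, κ)`, `α < κ ≤ n`, `α ≢ κ (mod 2)` (hypotheses of `ne_iff_event`), the unique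
optimum changes iff the pair flips, no position strictly between is uncovered, and EITHER both positions `α`, `κ` are uncovered (two adjacent particles
ANNIHILATE) OR `i+α+1 ∈ M` and `i+κ ∈ M` (a particle pair is CREATED at the two ends). [folklore] -/
theorem ne_iff_pair {i n α κ : ℕ} {θ θ' : ℝ} {M M' : Finset ℕ} (hακ : α < κ) (hκn : κ ≤ n) (hpar : Odd (α + κ))
    (hM : M ∈ indepSets i n) (hM' : M' ∈ indepSets i n)
    (huniq : ∀ T ∈ indepSets i n, T ≠ M → ∑ t ∈ T, W w₁ w₀ t θ < ∑ t ∈ M, W w₁ w₀ t θ)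
    (huniq' : ∀ T ∈ indepSets i n, T ≠ M' → ∑ t ∈ T, W w₁ w₀ t θ' < ∑ t ∈ M', W w₁ w₀ t θ')
    (hord : ∀ p q, p ≤ n → q ≤ n → ¬(p = α ∧ q = κ) → ¬(p = κ ∧ q = α) →
      (L (altA (shift i w₁)) (altB (shift i w₀)) p θ < L (altA (shift i w₁)) (altB (shift i w₀)) q θ ↔
        L (altA (shift i w₁)) (altB (shift i w₀)) p θ' < L (altA (shift i w₁)) (altB (shift i w₀)) q θ'))
    (hdis : ∀ p q, p ≤ n → q ≤ n → p ≠ q → L (altA (shift i w₁)) (altB (shift i w₀)) p θ ≠ L (altA (shift i w₁)) (altB (shift i w₀)) q θ)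
    (hdis' : ∀ p q, p ≤ n → q ≤ n → p ≠ q → L (altA (shift i w₁)) (altB (shift i w₀)) p θ' ≠ L (altA (shift i w₁)) (altB (shift i w₀)) q θ')
    (hadj : ∀ x, x ≤ n → x ≠ α → x ≠ κ →
      (L (altA (shift i w₁)) (altB (shift i w₀)) x θ < L (altA (shift i w₁)) (altB (shift i w₀)) α θ ↔
        L (altA (shift i w₁)) (altB (shift i w₀)) x θ < L (altA (shift i w₁)) (altB (shift i w₀)) κ θ)) :
    M ≠ M' ↔
      ((L (altA (shift i w₁)) (altB (shift i w₀)) α θ < L (altA (shift i w₁)) (altB (shift i w₀)) κ θ ↔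
          ¬ L (altA (shift i w₁)) (altB (shift i w₀)) α θ' < L (altA (shift i w₁)) (altB (shift i w₀)) κ θ') ∧
        (∀ x, α < x → x < κ → ¬ (i + x ∉ M ∧ i + x + 1 ∉ M)) ∧
        (((i + α ∉ M ∧ i + α + 1 ∉ M) ∧ (i + κ ∉ M ∧ i + κ + 1 ∉ M)) ∨ (i + α + 1 ∈ M ∧ i + κ ∈ M))) := by
  rw [ne_iff_flip_and_indep_symmDiff w₁ w₀ hακ hκn hM hM' huniq huniq' hord hdis hdis' hadj, mem_indepSets,
    indep_symmDiff_iff_of_mixed_parity (mem_indepSets.mp hM).2 hακ hpar]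
  have hsub : M ∆ Ioc (i + α) (i + κ) ⊆ Ioc i (i + n) := by
    intro t ht
    rw [Finset.mem_symmDiff] at ht
    rcases ht with ⟨htM, _⟩ | ⟨htI, _⟩
    · exact (mem_indepSets.mp hM).1 htM
    · have := mem_Ioc.mp htI; exact mem_Ioc.mpr ⟨by omega, by omega⟩
  tauto

end Dictionary

end

end StaticPathFold

end Summit.ValiantsHypothesis.ValiantsHypothesis.Theorems.KPlusLogSqLaw
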